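import Literature.Computability.MetaComplexity.MCSP
import Literature.Computability.Complexity.CircuitComposition
import Literature.Computability.QuantumComplexity.ForrelationMemCorrect
import HarnessLib

/-!
# Solo (informed) — the alternating-caterpillar fooling family inside `MCSP[n]`

Support file for `SoloInformedStreamingRung.lean` (the unconditional rungs `c ≤ 1` of the
McKay–Murray–Williams streaming lower bound for `MCSP[n]`).  Contents:

* `cat z b l` — the *alternating caterpillar* `x_{a₀} ∧ (x_{a₁} ∨ (x_{a₂} ∧ (⋯ ⋆ x_z)))` on the
  variable list `l = [a₀, a₁, …]` with terminal variable `z`: a read-once formula with `|l|` gates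
  over `B₂` (`cktSize_cat`); the variable LIST is determined by the function (`cat_injective`: the
  head is detected by a single evaluation, `cat_update_detect`, and the tail by restriction);
* (reused from the tree: `ForrMem.truthTable_snoc` — the two halves of a truth table are the truth
  tables of the two restrictions of the last, most significant, variable;)
* the family `gFun k π` (`π` a permutation of `k+1` variables; `(k+1)!` members, `gFun_injective`)
  and the diagonal words `tt(g_π) ++ tt(g_π) = tt(diag k π) ∈ MCSP[n]`, `n = k + 3` (`diag_mem`).
-/

noncomputable section

namespace Summit.PneNP.PneNP.Theorems

open Finset
open Literature.Computability.Complexity Literature.Computability.MetaComplexity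

/-! ### The alternating caterpillar -/

/-- The alternating caterpillar on the variable list `l` with terminal variable `z`, read at level
`b` (`b = true`: an `∧`-level, `b = false`: an `∨`-level):
`cat z true (a :: l) v = v a ∧ cat z false l v`, `cat z false (a :: l) v = v a ∨ cat z true l v`,
`cat z b [] v = v z`. -/
def cat {m : ℕ} (z : Fin m) : Bool → List (Fin m) → (Fin m → Bool) → Bool
  | _, [], v => v z
  | b, a :: l, v => if v a = b then cat z (!b) l v else !b

variable {m : ℕ} (z : Fin m)

/-- The empty caterpillar reads the terminal. -/
@[simp] theorem cat_nil (b : Bool) (v : Fin m → Bool) : cat z b [] v = v z := rfl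

/-- One level of the caterpillar. -/
@[simp] theorem cat_cons (b : Bool) (a : Fin m) (l : List (Fin m)) (v : Fin m → Bool) :
    cat z b (a :: l) v = if v a = b then cat z (!b) l v else !b := rfl

/-- The caterpillar only reads its own variables and the terminal. -/
theorem cat_congr {v w : Fin m → Bool} :
    ∀ (l : List (Fin m)) (b : Bool), (∀ i ∈ l, v i = w i) → v z = w z → cat z b l v = cat z b l w
  | [], b, _, hz => by simpa using hz
  | a :: l, b, hl, hz => by
    simp only [cat_cons, hl a (by simp)]
    rw [cat_congr l (!b) (fun i hi => hl i (by simp [hi])) hz]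

/-- Updating a variable outside the caterpillar does not change it. -/
theorem cat_update {a : Fin m} (l : List (Fin m)) (b : Bool) (ha : a ∉ l) (haz : a ≠ z)
    (v : Fin m → Bool) (x : Bool) : cat z b l (Function.update v a x) = cat z b l v :=
  cat_congr z l b (fun i hi => Function.update_of_ne (fun h : i = a => ha (h ▸ hi)) _ _)
    (Function.update_of_ne haz.symm _ _)

/-- If all variables of the caterpillar and the terminal read `c`, the caterpillar reads `c`. -/
theorem cat_const {v : Fin m → Bool} {c : Bool} :
    ∀ (l : List (Fin m)) (e : Bool), (∀ i ∈ l, v i = c) → v z = c → cat z e l v = c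
  | [], e, _, hz => by simpa using hz
  | a :: l, e, hl, hz => by
    have ha : v a = c := hl a (by simp)
    simp only [cat_cons, ha]
    by_cases hce : c = e
    · rw [if_pos hce]; exact cat_const l (!e) (fun i hi => hl i (by simp [hi])) hz
    · rw [if_neg hce]; cases c <;> cases e <;> simp_all

/-- **Head detection**: on the assignment "everything `b` except variable `c` set to `¬b`", a
caterpillar at level `b` with distinct variables (terminal not among them, `c` not the terminal)
reads `¬b` iff `c` is its head. -/
theorem cat_update_detect {a c : Fin m} {t : List (Fin m)} (b : Bool) (hnd : (a :: t).Nodup)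
    (hz : z ∉ a :: t) (hcz : c ≠ z) :
    cat z b (a :: t) (Function.update (fun _ => b) c (!b)) = if c = a then !b else b := by
  by_cases hca : c = a
  · subst hca
    simp
  · rw [if_neg hca, cat_cons, Function.update_of_ne (Ne.symm hca), if_pos rfl]
    cases t with
    | nil => simpa using Function.update_of_ne hcz.symm (!b) (fun _ => b)
    | cons a₂ t₂ =>
      rw [cat_cons]
      by_cases hc2 : c = a₂
      · subst hc2
        rw [Function.update_self, if_pos rfl, Bool.not_not]
        have hct : c ∉ t₂ := by
          have := (List.nodup_cons.1 (List.nodup_cons.1 hnd).2).1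
          exact this
        exact cat_const z t₂ b (fun i hi => Function.update_of_ne (fun h : i = c => hct (h ▸ hi)) _ _)
          (Function.update_of_ne hcz.symm _ _)
      · rw [Function.update_of_ne (Ne.symm hc2)]
        cases b <;> simp

/-- **Distinct variable lists give distinct caterpillars.** -/
theorem cat_injective : ∀ (l l' : List (Fin m)) (b : Bool), l.Nodup → l'.Nodup → z ∉ l → z ∉ l' →
    l.length = l'.length → cat z b l = cat z b l' → l = l'
  | [], [], _, _, _, _, _, _, _ => rfl
  | [], _ :: _, _, _, _, _, _, h, _ => by simp at h
  | _ :: _, [], _, _, _, _, _, h, _ => by simp at h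
  | a :: t, a' :: t', b, hnd, hnd', hz, hz', hlen, H => by
    have haz : a ≠ z := fun h => hz (by simp [h])
    -- the heads agree
    have hhead : a = a' := by
      have h1 := congrFun H (Function.update (fun _ => b) a (!b))
      rw [cat_update_detect z b hnd hz haz, cat_update_detect z b hnd' hz' haz, if_pos rfl] at h1
      by_contra hne
      rw [if_neg hne] at h1
      cases b <;> simp at h1
    subst hhead
    -- the tails agree
    have hat : a ∉ t := (List.nodup_cons.1 hnd).1
    have hat' : a ∉ t' := (List.nodup_cons.1 hnd').1
    have htail : cat z (!b) t = cat z (!b) t' := by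
      funext v
      have h1 := congrFun H (Function.update v a b)
      simp only [cat_cons, Function.update_self] at h1
      rwa [cat_update z t (!b) hat haz, cat_update z t' (!b) hat' haz] at h1
    rw [cat_injective t t' (!b) (List.nodup_cons.1 hnd).2 (List.nodup_cons.1 hnd').2
      (fun h => hz (by simp [h])) (fun h => hz' (by simp [h])) (by simpa using hlen) htail]

/-- **A caterpillar on `|l|` variables is a read-once formula with `|l|` gates over `B₂`.** -/
theorem cktSize_cat : ∀ (l : List (Fin m)) (b : Bool),
    CktSize B2 (fun (v : Fin m → Bool) (_ : Unit) => cat z b l v) l.length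
  | [], b => (CktSize.proj B2 fun _ : Unit => z).congr fun v _ => by simp
  | a :: l, b => by
    have h1 : CktSize B2 (fun (v : Fin m → Bool) => Sum.elim v (fun _ : Unit => cat z (!b) l v))
        (0 + l.length) := (CktSize.id B2).pair (cktSize_cat l (!b))
    cases b with
    | true =>
      refine ((h1.comp (cktSize_and (ι := Fin m ⊕ Unit) (.inl a) (.inr ()))).of_le
        (by simp)).congr fun v _ => ?_
      cases h : v a <;> simp [h]
    | false =>
      refine ((h1.comp (cktSize_or (ι := Fin m ⊕ Unit) (.inl a) (.inr ()))).of_le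
        (by simp)).congr fun v _ => ?_
      cases h : v a <;> simp [h]

/-! ### The fooling family -/

section Family

variable (k : ℕ)

/-- The variable list of the caterpillar `g_π`: variables `1, …, k+1` of `Fin (k+2)` in the order
`π`; variable `0` is the terminal. -/
def lst (π : Equiv.Perm (Fin (k + 1))) : List (Fin (k + 2)) := List.ofFn fun i => Fin.succ (π i)

/-- The caterpillar `g_π` on `k+2` variables. -/
def gFun (π : Equiv.Perm (Fin (k + 1))) : (Fin (k + 2) → Bool) → Bool := cat 0 true (lst k π)

/-- The diagonal function on `k+3` variables: `g_π`, ignoring the last variable. -/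
def diag (π : Equiv.Perm (Fin (k + 1))) : (Fin (k + 3) → Bool) → Bool := fun v => gFun k π (Fin.init v)

/-- The variable list has `k + 1` entries. -/
theorem length_lst (π : Equiv.Perm (Fin (k + 1))) : (lst k π).length = k + 1 := by simp [lst]

/-- The variable list has no repetitions. -/
theorem nodup_lst (π : Equiv.Perm (Fin (k + 1))) : (lst k π).Nodup :=
  List.nodup_ofFn.2 ((Fin.succ_injective _).comp π.injective)

/-- The terminal `0` is not in the variable list. -/
theorem zero_not_mem_lst (π : Equiv.Perm (Fin (k + 1))) : (0 : Fin (k + 2)) ∉ lst k π := by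
  rw [lst, List.mem_ofFn]
  rintro ⟨i, hi⟩
  exact Fin.succ_ne_zero _ hi

/-- **The family is injective.** -/
theorem gFun_injective : Function.Injective (gFun k) := by
  intro π π' h
  have hl : lst k π = lst k π' :=
    cat_injective 0 _ _ true (nodup_lst k π) (nodup_lst k π') (zero_not_mem_lst k π)
      (zero_not_mem_lst k π') (by simp [length_lst]) h
  have := List.ofFn_injective hl
  exact Equiv.ext fun i => Fin.succ_injective _ (congrFun this i)

/-- The diagonal functions have circuits of size `k + 1`. -/
theorem circuitSizeOver_diag_le (π : Equiv.Perm (Fin (k + 1))) :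
    circuitSizeOver B2 (diag k π) ≤ k + 1 := by
  have h : CktSize B2 (fun (v : Fin (k + 3) → Bool) (_ : Unit) => diag k π v) (lst k π).length :=
    ((cktSize_cat 0 (lst k π) true).rewire Fin.castSucc).congr fun v _ => rfl
  obtain ⟨C, hB, hs, hC⟩ := h.toCircuit
  exact (circuitSizeOver_le_of_computes C hB hC).trans (hs.trans (length_lst k π).le)

/-- The diagonal word `tt(g_π) ++ tt(g_π)` is the truth table of the diagonal function. -/
theorem truthTable_diag (π : Equiv.Perm (Fin (k + 1))) :
    truthTable (diag k π) = truthTable (gFun k π) ++ truthTable (gFun k π) := by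
  rw [Literature.Computability.QuantumComplexity.ForrMem.truthTable_snoc]
  simp [diag, Fin.init_snoc]

/-- The diagonal words are in `MCSP[n]`. -/
theorem diag_mem (π : Equiv.Perm (Fin (k + 1))) :
    truthTable (gFun k π) ++ truthTable (gFun k π) ∈ MCSPSize (fun n => n) :=
  ⟨k + 3, diag k π, (truthTable_diag k π).symm, (circuitSizeOver_diag_le k π).trans (by dsimp only; omega)⟩

/-- All words of the family have length `N = 2^{k+3}`. -/
theorem length_word (π π' : Equiv.Perm (Fin (k + 1))) :
    (truthTable (gFun k π) ++ truthTable (gFun k π')).length = 2 ^ (k + 3) := by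
  simp [length_truthTable, pow_succ]; ring

end Family

end Summit.PneNP.PneNP.Theorems
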